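import Summits.KontsevichZagierPeriods.KontsevichZagierPeriods.Theorems.FurushoPentagonPentagonInKZCornerCubes
import Summits.KontsevichZagierPeriods.KontsevichZagierPeriods.Theorems.FurushoPentagonPentagonInKZCornerBlocks
import Literature.NumberTheory.Transcendental.Associators

/-!
# `PentagonInKZ`, line `edge-normal-newton-leibniz`: corner engine — abstract signature, mirror symmetry

The corner engine of the crux `FurushoPentagon.PentagonInKZ` (stub `cornerEngine_uniformlyNull`,
stmt-KontsevichZagierPeriods-11348) is developed over an ABSTRACT signature: hypothesised objects
(two regularised letters, residues, letter densities, regularised word integrands, insertion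
operators, the two edge transports paired with a functional, the defect, coordinate blocks) and
ONE hypothesis bundle `H` listing their properties (defining equations, edge values, peeling
identities, edge centralities, functional-level flatness / commutation / letter centralities,
calculus, semialgebraicity, bounds).  The bundle is symmetric under the exchange of the two
directions: `mirror_hyp` carries `H` to the bundle of the mirror dictionary, so that every engine
lemma has a mirror image by instantiation.  This file also provides the generic re-association
(`recast_rep`, `recast_rep_eq`) of representations (block exchange is `collect_swap_blocks_rep` of
`…CornerEngineCollect`).

References: V. G. Drinfeld, Leningrad Math. J. 2 (1991), §2; M. Kontsevich, D. Zagier, *Periods*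
(2001), §1.2.
-/

noncomputable section

open Set MeasureTheory
open Literature.NumberTheory.Transcendental
open Literature.ModelTheory.ExponentialFields (IsSemialgebraic)

namespace Summit.KontsevichZagierPeriods.FurushoPentagon.PentagonInKZ

section AbstractEngine

variable {m N : ℕ} {ℓ ℓ' : Fin (m + 2)} {α β : ℚ}
  {Zq : Fin (m + 2) → (DrinfeldKohnoTrunc ℚ (Fin 4) N)} {wZ : ∀ {n : ℕ}, (Fin n → Fin (m + 2)) → (DrinfeldKohnoTrunc ℚ (Fin 4) N)}
  {fd gd dd : Fin (m + 2) → ℝ → ℝ → ℝ}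
  {Ht Vt dHt dVt : ∀ {n : ℕ}, (Fin n → Fin (m + 2)) → (Fin n → ℝ) → ℝ → ℝ → ℝ}
  {op opV : Fin (m + 2) → (DrinfeldKohnoTrunc ℚ (Fin 4) N) →ₗ[ℚ] (DrinfeldKohnoTrunc ℚ (Fin 4) N)}
  {Af Bf dAf dBf F : ((DrinfeldKohnoTrunc ℚ (Fin 4) N) →ₗ[ℚ] ℚ) → ∀ {k l : ℕ}, (Fin k → ℝ) → (Fin l → ℝ) → ℝ → ℝ → ℝ}
  {Xb : ∀ k l e : ℕ, (Fin (k + l + e) → ℝ) → Fin k → ℝ}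
  {Yb : ∀ k l e : ℕ, (Fin (k + l + e) → ℝ) → Fin l → ℝ}
  {Θb : ∀ k l e : ℕ, (Fin (k + l + e) → ℝ) → Fin e → ℝ}

variable (H :
    (∀ {n : ℕ} (U : Fin n → Fin (m + 2)), wZ U = ((List.ofFn U).map Zq).prod) ∧
    (∀ (a : Fin (m + 2)) (X : (DrinfeldKohnoTrunc ℚ (Fin 4) N)), op a X = if a = ℓ then Zq ℓ * X - X * Zq ℓ else Zq a * X) ∧
    (∀ (b : Fin (m + 2)) (X : (DrinfeldKohnoTrunc ℚ (Fin 4) N)), opV b X = if b = ℓ' then Zq ℓ' * X - X * Zq ℓ' else Zq b * X) ∧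
    (∀ (μ : (DrinfeldKohnoTrunc ℚ (Fin 4) N) →ₗ[ℚ] ℚ) {k l : ℕ} (x : Fin k → ℝ) (y : Fin l → ℝ) (ξ η : ℝ), Af μ x y ξ η = ∑ U : Fin k → Fin (m + 2), ∑ V : Fin l → Fin (m + 2), (μ (wZ U * wZ V) : ℝ) * (Ht U x ξ η * Vt V y 0 η)) ∧
    (∀ (μ : (DrinfeldKohnoTrunc ℚ (Fin 4) N) →ₗ[ℚ] ℚ) {k l : ℕ} (x : Fin k → ℝ) (y : Fin l → ℝ) (ξ η : ℝ), Bf μ x y ξ η = ∑ U : Fin k → Fin (m + 2), ∑ V : Fin l → Fin (m + 2), (μ (wZ V * wZ U) : ℝ) * (Vt V y ξ η * Ht U x ξ 0)) ∧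
    (∀ (μ : (DrinfeldKohnoTrunc ℚ (Fin 4) N) →ₗ[ℚ] ℚ) {k l : ℕ} (x : Fin k → ℝ) (y : Fin l → ℝ) (ξ η : ℝ), dAf μ x y ξ η = ∑ U : Fin k → Fin (m + 2), ∑ V : Fin l → Fin (m + 2), (μ (wZ U * wZ V) : ℝ) * (dHt U x ξ η * Vt V y 0 η)) ∧
    (∀ (μ : (DrinfeldKohnoTrunc ℚ (Fin 4) N) →ₗ[ℚ] ℚ) {k l : ℕ} (x : Fin k → ℝ) (y : Fin l → ℝ) (ξ η : ℝ), dBf μ x y ξ η = ∑ U : Fin k → Fin (m + 2), ∑ V : Fin l → Fin (m + 2), (μ (wZ V * wZ U) : ℝ) * (dVt V y ξ η * Ht U x ξ 0)) ∧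
    (∀ (μ : (DrinfeldKohnoTrunc ℚ (Fin 4) N) →ₗ[ℚ] ℚ) {k l : ℕ} (x : Fin k → ℝ) (y : Fin l → ℝ) (ξ η : ℝ), F μ x y ξ η = Af μ x y ξ η - Bf μ x y ξ η) ∧
    (∀ (k l e : ℕ) (z : Fin (k + l + e) → ℝ), Xb k l e z = fun i => z (Fin.castAdd e (Fin.castAdd l i))) ∧
    (∀ (k l e : ℕ) (z : Fin (k + l + e) → ℝ), Yb k l e z = fun j => z (Fin.castAdd e (Fin.natAdd k j))) ∧
    (∀ (k l e : ℕ) (z : Fin (k + l + e) → ℝ), Θb k l e z = fun s => z (Fin.natAdd (k + l) s)) ∧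
    (∀ (U : Fin 0 → Fin (m + 2)) (x : Fin 0 → ℝ) (ξ η : ℝ), Ht U x ξ η = 1) ∧
    (∀ (V : Fin 0 → Fin (m + 2)) (y : Fin 0 → ℝ) (ξ η : ℝ), Vt V y ξ η = 1) ∧
    (∀ (U : Fin 0 → Fin (m + 2)) (x : Fin 0 → ℝ) (ξ η : ℝ), dHt U x ξ η = 0) ∧
    (∀ (V : Fin 0 → Fin (m + 2)) (y : Fin 0 → ℝ) (ξ η : ℝ), dVt V y ξ η = 0) ∧
    (∀ {k : ℕ} (U : Fin (k + 1) → Fin (m + 2)) (x : Fin (k + 1) → ℝ) (η : ℝ), Ht U x 0 η = 0) ∧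
    (∀ {l : ℕ} (V : Fin (l + 1) → Fin (m + 2)) (y : Fin (l + 1) → ℝ) (ξ : ℝ), Vt V y ξ 0 = 0) ∧
    (∀ t y : ℝ, fd ℓ t y = 1 / t) ∧
    (∀ x s : ℝ, gd ℓ' x s = 1 / s) ∧
    (∀ x y : ℝ, dd ℓ x y = 0) ∧
    (∀ x y : ℝ, dd ℓ' x y = 0) ∧
    (∀ (μ : (DrinfeldKohnoTrunc ℚ (Fin 4) N) →ₗ[ℚ] ℚ) {k : ℕ} (x₀ : ℝ) (x' : Fin k → ℝ) (ξ η : ℝ), ∑ U : Fin (k + 1) → Fin (m + 2), (μ (wZ U) : ℝ) * Ht U (Fin.cons x₀ x') ξ η = (∑ a : Fin (m + 2), (if a = ℓ then 1 / x₀ else ξ * fd a (ξ * x₀) η) * ∑ U' : Fin k → Fin (m + 2), (μ (Zq a * wZ U') : ℝ) * Ht U' x' (ξ * x₀) η) - (1 / x₀) * ∑ U' : Fin k → Fin (m + 2), (μ (wZ U' * Zq ℓ) : ℝ) * Ht U' x' (ξ * x₀) η) ∧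
    (∀ (μ : (DrinfeldKohnoTrunc ℚ (Fin 4) N) →ₗ[ℚ] ℚ) {l : ℕ} (y₀ : ℝ) (y' : Fin l → ℝ) (ξ η : ℝ), ∑ V : Fin (l + 1) → Fin (m + 2), (μ (wZ V) : ℝ) * Vt V (Fin.cons y₀ y') ξ η = (∑ b : Fin (m + 2), (if b = ℓ' then 1 / y₀ else η * gd b ξ (η * y₀)) * ∑ V' : Fin l → Fin (m + 2), (μ (Zq b * wZ V') : ℝ) * Vt V' y' ξ (η * y₀)) - (1 / y₀) * ∑ V' : Fin l → Fin (m + 2), (μ (wZ V' * Zq ℓ') : ℝ) * Vt V' y' ξ (η * y₀)) ∧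
    (∀ (μ : (DrinfeldKohnoTrunc ℚ (Fin 4) N) →ₗ[ℚ] ℚ) {l : ℕ} (P Q : (DrinfeldKohnoTrunc ℚ (Fin 4) N)) (y : Fin l → ℝ) (η : ℝ), (∀ i, 0 < y i ∧ y i < 1) → 0 < η → η ≤ (β : ℝ) → ∑ V : Fin l → Fin (m + 2), (μ (P * (Zq ℓ * wZ V - wZ V * Zq ℓ) * Q) : ℝ) * Vt V y 0 η = 0) ∧
    (∀ (μ : (DrinfeldKohnoTrunc ℚ (Fin 4) N) →ₗ[ℚ] ℚ) {k : ℕ} (P Q : (DrinfeldKohnoTrunc ℚ (Fin 4) N)) (x : Fin k → ℝ) (ξ : ℝ), (∀ i, 0 < x i ∧ x i < 1) → 0 < ξ → ξ ≤ (α : ℝ) → ∑ U : Fin k → Fin (m + 2), (μ (P * (Zq ℓ' * wZ U - wZ U * Zq ℓ') * Q) : ℝ) * Ht U x ξ 0 = 0) ∧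
    (∀ (μ : (DrinfeldKohnoTrunc ℚ (Fin 4) N) →ₗ[ℚ] ℚ) (P Q : (DrinfeldKohnoTrunc ℚ (Fin 4) N)), μ (P * (Zq ℓ * Zq ℓ' - Zq ℓ' * Zq ℓ) * Q) = 0) ∧
    (∀ (μ : (DrinfeldKohnoTrunc ℚ (Fin 4) N) →ₗ[ℚ] ℚ) (P Q : (DrinfeldKohnoTrunc ℚ (Fin 4) N)) (x y : ℝ), 0 < x → x < (α : ℝ) → 0 < y → y < (β : ℝ) → ∑ a : Fin (m + 2), ∑ b : Fin (m + 2), (fd a x y * gd b x y) * (μ (P * (Zq a * Zq b - Zq b * Zq a) * Q) : ℝ) = 0) ∧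
    (∀ (μ : (DrinfeldKohnoTrunc ℚ (Fin 4) N) →ₗ[ℚ] ℚ) (P Q : (DrinfeldKohnoTrunc ℚ (Fin 4) N)) (s : ℝ), 0 < s → s < (β : ℝ) → ∑ b : Fin (m + 2), gd b 0 s * (μ (P * (Zq ℓ * Zq b - Zq b * Zq ℓ) * Q) : ℝ) = 0) ∧
    (∀ (μ : (DrinfeldKohnoTrunc ℚ (Fin 4) N) →ₗ[ℚ] ℚ) (P Q : (DrinfeldKohnoTrunc ℚ (Fin 4) N)) (t : ℝ), 0 < t → t < (α : ℝ) → ∑ a : Fin (m + 2), fd a t 0 * (μ (P * (Zq ℓ' * Zq a - Zq a * Zq ℓ') * Q) : ℝ) = 0) ∧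
    (∀ (a : Fin (m + 2)) (ξ η : ℝ), 0 ≤ ξ → ξ ≤ (α : ℝ) → 0 ≤ η → η ≤ (β : ℝ) → HasDerivAt (fun y => fd a ξ y) (dd a ξ η) η) ∧
    (∀ (b : Fin (m + 2)) (ξ η : ℝ), 0 ≤ ξ → ξ ≤ (α : ℝ) → 0 ≤ η → η ≤ (β : ℝ) → HasDerivAt (fun x => gd b x η) (dd b ξ η) ξ) ∧
    (∀ {k : ℕ} (U : Fin k → Fin (m + 2)) (x : Fin k → ℝ) (ξ η : ℝ), (∀ i, 0 ≤ x i ∧ x i ≤ 1) → 0 ≤ ξ → ξ ≤ (α : ℝ) → 0 ≤ η → η ≤ (β : ℝ) → HasDerivAt (fun t => Ht U x t η) (dHt U x ξ η) ξ) ∧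
    (∀ {l : ℕ} (V : Fin l → Fin (m + 2)) (y : Fin l → ℝ) (ξ η : ℝ), (∀ i, 0 ≤ y i ∧ y i ≤ 1) → 0 ≤ ξ → ξ ≤ (α : ℝ) → 0 ≤ η → η ≤ (β : ℝ) → HasDerivAt (fun s => Vt V y ξ s) (dVt V y ξ η) η) ∧
    (∀ {k : ℕ} (U : Fin (k + 1) → Fin (m + 2)) (x₀ : ℝ) (x' : Fin k → ℝ) (ξ η : ℝ), 0 < x₀ → x₀ < 1 → (∀ i, 0 ≤ x' i ∧ x' i ≤ 1) → 0 ≤ ξ → ξ ≤ (α : ℝ) → 0 ≤ η → η ≤ (β : ℝ) → HasDerivAt (fun t => t * Ht U (Fin.cons t x') ξ η) (ξ * dHt U (Fin.cons x₀ x') ξ η) x₀) ∧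
    (∀ {l : ℕ} (V : Fin (l + 1) → Fin (m + 2)) (y₀ : ℝ) (y' : Fin l → ℝ) (ξ η : ℝ), 0 < y₀ → y₀ < 1 → (∀ i, 0 ≤ y' i ∧ y' i ≤ 1) → 0 ≤ ξ → ξ ≤ (α : ℝ) → 0 ≤ η → η ≤ (β : ℝ) → HasDerivAt (fun t => t * Vt V (Fin.cons t y') ξ η) (η * dVt V (Fin.cons y₀ y') ξ η) y₀) ∧
    (∀ {k : ℕ} (U : Fin (k + 1) → Fin (m + 2)) (x' : Fin k → ℝ) (ξ η : ℝ), (∀ i, 0 ≤ x' i ∧ x' i ≤ 1) → 0 ≤ ξ → ξ ≤ (α : ℝ) → 0 ≤ η → η ≤ (β : ℝ) → ContinuousOn (fun t => t * Ht U (Fin.cons t x') ξ η) (Set.Icc 0 1)) ∧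
    (∀ {l : ℕ} (V : Fin (l + 1) → Fin (m + 2)) (y' : Fin l → ℝ) (ξ η : ℝ), (∀ i, 0 ≤ y' i ∧ y' i ≤ 1) → 0 ≤ ξ → ξ ≤ (α : ℝ) → 0 ≤ η → η ≤ (β : ℝ) → ContinuousOn (fun t => t * Vt V (Fin.cons t y') ξ η) (Set.Icc 0 1)) ∧
    (∀ {d : ℕ} {W : Set (Fin d → ℝ)}, IsSemialgebraic ℚ W → ∀ (a : Fin (m + 2)) {T Y : (Fin d → ℝ) → ℝ}, IsSemialgebraicFunOn ℚ W T → IsSemialgebraicFunOn ℚ W Y → IsSemialgebraicFunOn ℚ W fun z => fd a (T z) (Y z)) ∧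
    (∀ {d : ℕ} {W : Set (Fin d → ℝ)}, IsSemialgebraic ℚ W → ∀ (b : Fin (m + 2)) {T Y : (Fin d → ℝ) → ℝ}, IsSemialgebraicFunOn ℚ W T → IsSemialgebraicFunOn ℚ W Y → IsSemialgebraicFunOn ℚ W fun z => gd b (T z) (Y z)) ∧
    (∀ {d : ℕ} {W : Set (Fin d → ℝ)}, IsSemialgebraic ℚ W → ∀ (a : Fin (m + 2)) {T Y : (Fin d → ℝ) → ℝ}, IsSemialgebraicFunOn ℚ W T → IsSemialgebraicFunOn ℚ W Y → IsSemialgebraicFunOn ℚ W fun z => dd a (T z) (Y z)) ∧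
    (∀ {d : ℕ} {W : Set (Fin d → ℝ)}, IsSemialgebraic ℚ W → ∀ {n : ℕ} (U : Fin n → Fin (m + 2)) {X : (Fin d → ℝ) → Fin n → ℝ} {P Q : (Fin d → ℝ) → ℝ}, (∀ i, IsSemialgebraicFunOn ℚ W fun z => X z i) → IsSemialgebraicFunOn ℚ W P → IsSemialgebraicFunOn ℚ W Q → IsSemialgebraicFunOn ℚ W fun z => Ht U (X z) (P z) (Q z)) ∧
    (∀ {d : ℕ} {W : Set (Fin d → ℝ)}, IsSemialgebraic ℚ W → ∀ {n : ℕ} (V : Fin n → Fin (m + 2)) {Y : (Fin d → ℝ) → Fin n → ℝ} {P Q : (Fin d → ℝ) → ℝ}, (∀ i, IsSemialgebraicFunOn ℚ W fun z => Y z i) → IsSemialgebraicFunOn ℚ W P → IsSemialgebraicFunOn ℚ W Q → IsSemialgebraicFunOn ℚ W fun z => Vt V (Y z) (P z) (Q z)) ∧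
    (∀ {d : ℕ} {W : Set (Fin d → ℝ)}, IsSemialgebraic ℚ W → ∀ {n : ℕ} (U : Fin n → Fin (m + 2)) {X : (Fin d → ℝ) → Fin n → ℝ} {P Q : (Fin d → ℝ) → ℝ}, (∀ i, IsSemialgebraicFunOn ℚ W fun z => X z i) → IsSemialgebraicFunOn ℚ W P → IsSemialgebraicFunOn ℚ W Q → IsSemialgebraicFunOn ℚ W fun z => dHt U (X z) (P z) (Q z)) ∧
    (∀ {d : ℕ} {W : Set (Fin d → ℝ)}, IsSemialgebraic ℚ W → ∀ {n : ℕ} (V : Fin n → Fin (m + 2)) {Y : (Fin d → ℝ) → Fin n → ℝ} {P Q : (Fin d → ℝ) → ℝ}, (∀ i, IsSemialgebraicFunOn ℚ W fun z => Y z i) → IsSemialgebraicFunOn ℚ W P → IsSemialgebraicFunOn ℚ W Q → IsSemialgebraicFunOn ℚ W fun z => dVt V (Y z) (P z) (Q z)) ∧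
    (∃ C : ℝ, ∀ (a : Fin (m + 2)) (ξ η : ℝ), 0 ≤ ξ → ξ ≤ (α : ℝ) → 0 ≤ η → η ≤ (β : ℝ) → (a ≠ ℓ → |fd a ξ η| ≤ C) ∧ (a ≠ ℓ' → |gd a ξ η| ≤ C) ∧ |dd a ξ η| ≤ C ∧ (∀ η' : ℝ, 0 ≤ η' → η' ≤ (β : ℝ) → |fd a ξ η - fd a ξ η'| ≤ C * |η - η'|) ∧ (∀ ξ' : ℝ, 0 ≤ ξ' → ξ' ≤ (α : ℝ) → |gd a ξ η - gd a ξ' η| ≤ C * |ξ - ξ'|)) ∧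
    (∀ k : ℕ, ∃ C : ℝ, ∀ (U : Fin k → Fin (m + 2)) (x : Fin k → ℝ) (ξ η : ℝ), (∀ i, 0 ≤ x i ∧ x i ≤ 1) → 0 ≤ ξ → ξ ≤ (α : ℝ) → 0 ≤ η → η ≤ (β : ℝ) → |Ht U x ξ η| ≤ C ∧ |dHt U x ξ η| ≤ C ∧ (0 < k → |Ht U x ξ η| ≤ C * ξ) ∧ (∀ η' : ℝ, 0 ≤ η' → η' ≤ (β : ℝ) → |Ht U x ξ η - Ht U x ξ η'| ≤ C * ξ * |η - η'|)) ∧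
    (∀ l : ℕ, ∃ C : ℝ, ∀ (V : Fin l → Fin (m + 2)) (y : Fin l → ℝ) (ξ η : ℝ), (∀ i, 0 ≤ y i ∧ y i ≤ 1) → 0 ≤ ξ → ξ ≤ (α : ℝ) → 0 ≤ η → η ≤ (β : ℝ) → |Vt V y ξ η| ≤ C ∧ |dVt V y ξ η| ≤ C ∧ (0 < l → |Vt V y ξ η| ≤ C * η) ∧ (∀ ξ' : ℝ, 0 ≤ ξ' → ξ' ≤ (α : ℝ) → |Vt V y ξ η - Vt V y ξ' η| ≤ C * η * |ξ - ξ'|)))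

/-! ### Generic recasting and block exchange of representations -/

/-- Re-associating the dimension `k₁ + l₁ + e = k₂ + l₂ + e` of a representation along equal block
sizes (no change of the underlying object). [folklore] -/
theorem recast_rep {e k₁ k₂ l₁ l₂ : ℕ} (hk : k₁ = k₂) (hl : l₁ = l₂)
    (G : ∀ k l : ℕ, (Fin (k + l + e) → ℝ) → ℝ) (R : KZ.IntegralRep (k₁ + l₁ + e))
    (hRd : R.domain = KZ.cube (k₁ + l₁ + e)) (hRi : EqOn R.integrand (G k₁ l₁) (KZ.cube (k₁ + l₁ + e))) :
    ∃ R' : KZ.IntegralRep (k₂ + l₂ + e), R'.domain = KZ.cube (k₂ + l₂ + e) ∧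
      EqOn R'.integrand (G k₂ l₂) (KZ.cube (k₂ + l₂ + e)) ∧
      KZ.toPeriodAlgebra (KZ.toFormalPeriod (KZ.of R')) = KZ.toPeriodAlgebra (KZ.toFormalPeriod (KZ.of R)) := by
  subst hk hl
  exact ⟨R, hRd, hRi, rfl⟩

/-- Re-associating the dimension of a representation along equal block sizes, integrand given as
a function. [folklore] -/
theorem recast_rep_eq {e k₁ k₂ l₁ l₂ : ℕ} (hk : k₁ = k₂) (hl : l₁ = l₂)
    (G : ∀ k l : ℕ, (Fin (k + l + e) → ℝ) → ℝ) (R : KZ.IntegralRep (k₁ + l₁ + e))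
    (hRd : R.domain = KZ.cube (k₁ + l₁ + e)) (hRi : R.integrand = G k₁ l₁) :
    ∃ R' : KZ.IntegralRep (k₂ + l₂ + e), R'.domain = KZ.cube (k₂ + l₂ + e) ∧ R'.integrand = G k₂ l₂ ∧
      KZ.toPeriodAlgebra (KZ.toFormalPeriod (KZ.of R')) = KZ.toPeriodAlgebra (KZ.toFormalPeriod (KZ.of R)) := by
  subst hk hl
  exact ⟨R, hRd, hRi, rfl⟩

/-! ### The mirror image of the hypothesis bundle -/

include H in
/-- **The hypothesis bundle is mirror symmetric**: exchanging the two directions (letters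
`ℓ ↔ ℓ'`, rectangle `α ↔ β`, densities `fd ↔ gd` with their arguments swapped, word integrands
`Ht ↔ Vt`, transports `Af ↔ Bf` with blocks and dilations swapped, defect `F ↦ −F`, insertion
operators `op ↔ opV`) carries the bundle to the bundle. [folklore] -/
theorem mirror_hyp :
    (∀ {n : ℕ} (U : Fin n → Fin (m + 2)), wZ U = ((List.ofFn U).map Zq).prod) ∧
    (∀ (a : Fin (m + 2)) (X : (DrinfeldKohnoTrunc ℚ (Fin 4) N)), opV a X = if a = ℓ' then Zq ℓ' * X - X * Zq ℓ' else Zq a * X) ∧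
    (∀ (b : Fin (m + 2)) (X : (DrinfeldKohnoTrunc ℚ (Fin 4) N)), op b X = if b = ℓ then Zq ℓ * X - X * Zq ℓ else Zq b * X) ∧
    (∀ (μ : (DrinfeldKohnoTrunc ℚ (Fin 4) N) →ₗ[ℚ] ℚ) {k l : ℕ} (x : Fin k → ℝ) (y : Fin l → ℝ) (ξ η : ℝ), (fun μ x y a b => Bf μ y x b a) μ x y ξ η = ∑ U : Fin k → Fin (m + 2), ∑ V : Fin l → Fin (m + 2), (μ (wZ U * wZ V) : ℝ) * ((fun U x a b => Vt U x b a) U x ξ η * (fun V y a b => Ht V y b a) V y 0 η)) ∧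
    (∀ (μ : (DrinfeldKohnoTrunc ℚ (Fin 4) N) →ₗ[ℚ] ℚ) {k l : ℕ} (x : Fin k → ℝ) (y : Fin l → ℝ) (ξ η : ℝ), (fun μ x y a b => Af μ y x b a) μ x y ξ η = ∑ U : Fin k → Fin (m + 2), ∑ V : Fin l → Fin (m + 2), (μ (wZ V * wZ U) : ℝ) * ((fun V y a b => Ht V y b a) V y ξ η * (fun U x a b => Vt U x b a) U x ξ 0)) ∧
    (∀ (μ : (DrinfeldKohnoTrunc ℚ (Fin 4) N) →ₗ[ℚ] ℚ) {k l : ℕ} (x : Fin k → ℝ) (y : Fin l → ℝ) (ξ η : ℝ), (fun μ x y a b => dBf μ y x b a) μ x y ξ η = ∑ U : Fin k → Fin (m + 2), ∑ V : Fin l → Fin (m + 2), (μ (wZ U * wZ V) : ℝ) * ((fun U x a b => dVt U x b a) U x ξ η * (fun V y a b => Ht V y b a) V y 0 η)) ∧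
    (∀ (μ : (DrinfeldKohnoTrunc ℚ (Fin 4) N) →ₗ[ℚ] ℚ) {k l : ℕ} (x : Fin k → ℝ) (y : Fin l → ℝ) (ξ η : ℝ), (fun μ x y a b => dAf μ y x b a) μ x y ξ η = ∑ U : Fin k → Fin (m + 2), ∑ V : Fin l → Fin (m + 2), (μ (wZ V * wZ U) : ℝ) * ((fun V y a b => dHt V y b a) V y ξ η * (fun U x a b => Vt U x b a) U x ξ 0)) ∧
    (∀ (μ : (DrinfeldKohnoTrunc ℚ (Fin 4) N) →ₗ[ℚ] ℚ) {k l : ℕ} (x : Fin k → ℝ) (y : Fin l → ℝ) (ξ η : ℝ), (fun μ x y a b => - F μ y x b a) μ x y ξ η = (fun μ x y a b => Bf μ y x b a) μ x y ξ η - (fun μ x y a b => Af μ y x b a) μ x y ξ η) ∧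
    (∀ (k l e : ℕ) (z : Fin (k + l + e) → ℝ), Xb k l e z = fun i => z (Fin.castAdd e (Fin.castAdd l i))) ∧
    (∀ (k l e : ℕ) (z : Fin (k + l + e) → ℝ), Yb k l e z = fun j => z (Fin.castAdd e (Fin.natAdd k j))) ∧
    (∀ (k l e : ℕ) (z : Fin (k + l + e) → ℝ), Θb k l e z = fun s => z (Fin.natAdd (k + l) s)) ∧
    (∀ (U : Fin 0 → Fin (m + 2)) (x : Fin 0 → ℝ) (ξ η : ℝ), (fun U x a b => Vt U x b a) U x ξ η = 1) ∧
    (∀ (V : Fin 0 → Fin (m + 2)) (y : Fin 0 → ℝ) (ξ η : ℝ), (fun V y a b => Ht V y b a) V y ξ η = 1) ∧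
    (∀ (U : Fin 0 → Fin (m + 2)) (x : Fin 0 → ℝ) (ξ η : ℝ), (fun U x a b => dVt U x b a) U x ξ η = 0) ∧
    (∀ (V : Fin 0 → Fin (m + 2)) (y : Fin 0 → ℝ) (ξ η : ℝ), (fun V y a b => dHt V y b a) V y ξ η = 0) ∧
    (∀ {k : ℕ} (U : Fin (k + 1) → Fin (m + 2)) (x : Fin (k + 1) → ℝ) (η : ℝ), (fun U x a b => Vt U x b a) U x 0 η = 0) ∧
    (∀ {l : ℕ} (V : Fin (l + 1) → Fin (m + 2)) (y : Fin (l + 1) → ℝ) (ξ : ℝ), (fun V y a b => Ht V y b a) V y ξ 0 = 0) ∧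
    (∀ t y : ℝ, (fun a t s => gd a s t) ℓ' t y = 1 / t) ∧
    (∀ x s : ℝ, (fun a t s => fd a s t) ℓ x s = 1 / s) ∧
    (∀ x y : ℝ, (fun a t s => dd a s t) ℓ' x y = 0) ∧
    (∀ x y : ℝ, (fun a t s => dd a s t) ℓ x y = 0) ∧
    (∀ (μ : (DrinfeldKohnoTrunc ℚ (Fin 4) N) →ₗ[ℚ] ℚ) {k : ℕ} (x₀ : ℝ) (x' : Fin k → ℝ) (ξ η : ℝ), ∑ U : Fin (k + 1) → Fin (m + 2), (μ (wZ U) : ℝ) * (fun U x a b => Vt U x b a) U (Fin.cons x₀ x') ξ η = (∑ a : Fin (m + 2), (if a = ℓ' then 1 / x₀ else ξ * (fun a t s => gd a s t) a (ξ * x₀) η) * ∑ U' : Fin k → Fin (m + 2), (μ (Zq a * wZ U') : ℝ) * (fun U x a b => Vt U x b a) U' x' (ξ * x₀) η) - (1 / x₀) * ∑ U' : Fin k → Fin (m + 2), (μ (wZ U' * Zq ℓ') : ℝ) * (fun U x a b => Vt U x b a) U' x' (ξ * x₀) η) ∧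
    (∀ (μ : (DrinfeldKohnoTrunc ℚ (Fin 4) N) →ₗ[ℚ] ℚ) {l : ℕ} (y₀ : ℝ) (y' : Fin l → ℝ) (ξ η : ℝ), ∑ V : Fin (l + 1) → Fin (m + 2), (μ (wZ V) : ℝ) * (fun V y a b => Ht V y b a) V (Fin.cons y₀ y') ξ η = (∑ b : Fin (m + 2), (if b = ℓ then 1 / y₀ else η * (fun a t s => fd a s t) b ξ (η * y₀)) * ∑ V' : Fin l → Fin (m + 2), (μ (Zq b * wZ V') : ℝ) * (fun V y a b => Ht V y b a) V' y' ξ (η * y₀)) - (1 / y₀) * ∑ V' : Fin l → Fin (m + 2), (μ (wZ V' * Zq ℓ) : ℝ) * (fun V y a b => Ht V y b a) V' y' ξ (η * y₀)) ∧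
    (∀ (μ : (DrinfeldKohnoTrunc ℚ (Fin 4) N) →ₗ[ℚ] ℚ) {l : ℕ} (P Q : (DrinfeldKohnoTrunc ℚ (Fin 4) N)) (y : Fin l → ℝ) (η : ℝ), (∀ i, 0 < y i ∧ y i < 1) → 0 < η → η ≤ (α : ℝ) → ∑ V : Fin l → Fin (m + 2), (μ (P * (Zq ℓ' * wZ V - wZ V * Zq ℓ') * Q) : ℝ) * (fun V y a b => Ht V y b a) V y 0 η = 0) ∧
    (∀ (μ : (DrinfeldKohnoTrunc ℚ (Fin 4) N) →ₗ[ℚ] ℚ) {k : ℕ} (P Q : (DrinfeldKohnoTrunc ℚ (Fin 4) N)) (x : Fin k → ℝ) (ξ : ℝ), (∀ i, 0 < x i ∧ x i < 1) → 0 < ξ → ξ ≤ (β : ℝ) → ∑ U : Fin k → Fin (m + 2), (μ (P * (Zq ℓ * wZ U - wZ U * Zq ℓ) * Q) : ℝ) * (fun U x a b => Vt U x b a) U x ξ 0 = 0) ∧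
    (∀ (μ : (DrinfeldKohnoTrunc ℚ (Fin 4) N) →ₗ[ℚ] ℚ) (P Q : (DrinfeldKohnoTrunc ℚ (Fin 4) N)), μ (P * (Zq ℓ' * Zq ℓ - Zq ℓ * Zq ℓ') * Q) = 0) ∧
    (∀ (μ : (DrinfeldKohnoTrunc ℚ (Fin 4) N) →ₗ[ℚ] ℚ) (P Q : (DrinfeldKohnoTrunc ℚ (Fin 4) N)) (x y : ℝ), 0 < x → x < (β : ℝ) → 0 < y → y < (α : ℝ) → ∑ a : Fin (m + 2), ∑ b : Fin (m + 2), ((fun a t s => gd a s t) a x y * (fun a t s => fd a s t) b x y) * (μ (P * (Zq a * Zq b - Zq b * Zq a) * Q) : ℝ) = 0) ∧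
    (∀ (μ : (DrinfeldKohnoTrunc ℚ (Fin 4) N) →ₗ[ℚ] ℚ) (P Q : (DrinfeldKohnoTrunc ℚ (Fin 4) N)) (s : ℝ), 0 < s → s < (α : ℝ) → ∑ b : Fin (m + 2), (fun a t s => fd a s t) b 0 s * (μ (P * (Zq ℓ' * Zq b - Zq b * Zq ℓ') * Q) : ℝ) = 0) ∧
    (∀ (μ : (DrinfeldKohnoTrunc ℚ (Fin 4) N) →ₗ[ℚ] ℚ) (P Q : (DrinfeldKohnoTrunc ℚ (Fin 4) N)) (t : ℝ), 0 < t → t < (β : ℝ) → ∑ a : Fin (m + 2), (fun a t s => gd a s t) a t 0 * (μ (P * (Zq ℓ * Zq a - Zq a * Zq ℓ) * Q) : ℝ) = 0) ∧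
    (∀ (a : Fin (m + 2)) (ξ η : ℝ), 0 ≤ ξ → ξ ≤ (β : ℝ) → 0 ≤ η → η ≤ (α : ℝ) → HasDerivAt (fun y => (fun a t s => gd a s t) a ξ y) ((fun a t s => dd a s t) a ξ η) η) ∧
    (∀ (b : Fin (m + 2)) (ξ η : ℝ), 0 ≤ ξ → ξ ≤ (β : ℝ) → 0 ≤ η → η ≤ (α : ℝ) → HasDerivAt (fun x => (fun a t s => fd a s t) b x η) ((fun a t s => dd a s t) b ξ η) ξ) ∧
    (∀ {k : ℕ} (U : Fin k → Fin (m + 2)) (x : Fin k → ℝ) (ξ η : ℝ), (∀ i, 0 ≤ x i ∧ x i ≤ 1) → 0 ≤ ξ → ξ ≤ (β : ℝ) → 0 ≤ η → η ≤ (α : ℝ) → HasDerivAt (fun t => (fun U x a b => Vt U x b a) U x t η) ((fun U x a b => dVt U x b a) U x ξ η) ξ) ∧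
    (∀ {l : ℕ} (V : Fin l → Fin (m + 2)) (y : Fin l → ℝ) (ξ η : ℝ), (∀ i, 0 ≤ y i ∧ y i ≤ 1) → 0 ≤ ξ → ξ ≤ (β : ℝ) → 0 ≤ η → η ≤ (α : ℝ) → HasDerivAt (fun s => (fun V y a b => Ht V y b a) V y ξ s) ((fun V y a b => dHt V y b a) V y ξ η) η) ∧
    (∀ {k : ℕ} (U : Fin (k + 1) → Fin (m + 2)) (x₀ : ℝ) (x' : Fin k → ℝ) (ξ η : ℝ), 0 < x₀ → x₀ < 1 → (∀ i, 0 ≤ x' i ∧ x' i ≤ 1) → 0 ≤ ξ → ξ ≤ (β : ℝ) → 0 ≤ η → η ≤ (α : ℝ) → HasDerivAt (fun t => t * (fun U x a b => Vt U x b a) U (Fin.cons t x') ξ η) (ξ * (fun U x a b => dVt U x b a) U (Fin.cons x₀ x') ξ η) x₀) ∧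
    (∀ {l : ℕ} (V : Fin (l + 1) → Fin (m + 2)) (y₀ : ℝ) (y' : Fin l → ℝ) (ξ η : ℝ), 0 < y₀ → y₀ < 1 → (∀ i, 0 ≤ y' i ∧ y' i ≤ 1) → 0 ≤ ξ → ξ ≤ (β : ℝ) → 0 ≤ η → η ≤ (α : ℝ) → HasDerivAt (fun t => t * (fun V y a b => Ht V y b a) V (Fin.cons t y') ξ η) (η * (fun V y a b => dHt V y b a) V (Fin.cons y₀ y') ξ η) y₀) ∧
    (∀ {k : ℕ} (U : Fin (k + 1) → Fin (m + 2)) (x' : Fin k → ℝ) (ξ η : ℝ), (∀ i, 0 ≤ x' i ∧ x' i ≤ 1) → 0 ≤ ξ → ξ ≤ (β : ℝ) → 0 ≤ η → η ≤ (α : ℝ) → ContinuousOn (fun t => t * (fun U x a b => Vt U x b a) U (Fin.cons t x') ξ η) (Set.Icc 0 1)) ∧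
    (∀ {l : ℕ} (V : Fin (l + 1) → Fin (m + 2)) (y' : Fin l → ℝ) (ξ η : ℝ), (∀ i, 0 ≤ y' i ∧ y' i ≤ 1) → 0 ≤ ξ → ξ ≤ (β : ℝ) → 0 ≤ η → η ≤ (α : ℝ) → ContinuousOn (fun t => t * (fun V y a b => Ht V y b a) V (Fin.cons t y') ξ η) (Set.Icc 0 1)) ∧
    (∀ {d : ℕ} {W : Set (Fin d → ℝ)}, IsSemialgebraic ℚ W → ∀ (a : Fin (m + 2)) {T Y : (Fin d → ℝ) → ℝ}, IsSemialgebraicFunOn ℚ W T → IsSemialgebraicFunOn ℚ W Y → IsSemialgebraicFunOn ℚ W fun z => (fun a t s => gd a s t) a (T z) (Y z)) ∧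
    (∀ {d : ℕ} {W : Set (Fin d → ℝ)}, IsSemialgebraic ℚ W → ∀ (b : Fin (m + 2)) {T Y : (Fin d → ℝ) → ℝ}, IsSemialgebraicFunOn ℚ W T → IsSemialgebraicFunOn ℚ W Y → IsSemialgebraicFunOn ℚ W fun z => (fun a t s => fd a s t) b (T z) (Y z)) ∧
    (∀ {d : ℕ} {W : Set (Fin d → ℝ)}, IsSemialgebraic ℚ W → ∀ (a : Fin (m + 2)) {T Y : (Fin d → ℝ) → ℝ}, IsSemialgebraicFunOn ℚ W T → IsSemialgebraicFunOn ℚ W Y → IsSemialgebraicFunOn ℚ W fun z => (fun a t s => dd a s t) a (T z) (Y z)) ∧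
    (∀ {d : ℕ} {W : Set (Fin d → ℝ)}, IsSemialgebraic ℚ W → ∀ {n : ℕ} (U : Fin n → Fin (m + 2)) {X : (Fin d → ℝ) → Fin n → ℝ} {P Q : (Fin d → ℝ) → ℝ}, (∀ i, IsSemialgebraicFunOn ℚ W fun z => X z i) → IsSemialgebraicFunOn ℚ W P → IsSemialgebraicFunOn ℚ W Q → IsSemialgebraicFunOn ℚ W fun z => (fun U x a b => Vt U x b a) U (X z) (P z) (Q z)) ∧
    (∀ {d : ℕ} {W : Set (Fin d → ℝ)}, IsSemialgebraic ℚ W → ∀ {n : ℕ} (V : Fin n → Fin (m + 2)) {Y : (Fin d → ℝ) → Fin n → ℝ} {P Q : (Fin d → ℝ) → ℝ}, (∀ i, IsSemialgebraicFunOn ℚ W fun z => Y z i) → IsSemialgebraicFunOn ℚ W P → IsSemialgebraicFunOn ℚ W Q → IsSemialgebraicFunOn ℚ W fun z => (fun V y a b => Ht V y b a) V (Y z) (P z) (Q z)) ∧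
    (∀ {d : ℕ} {W : Set (Fin d → ℝ)}, IsSemialgebraic ℚ W → ∀ {n : ℕ} (U : Fin n → Fin (m + 2)) {X : (Fin d → ℝ) → Fin n → ℝ} {P Q : (Fin d → ℝ) → ℝ}, (∀ i, IsSemialgebraicFunOn ℚ W fun z => X z i) → IsSemialgebraicFunOn ℚ W P → IsSemialgebraicFunOn ℚ W Q → IsSemialgebraicFunOn ℚ W fun z => (fun U x a b => dVt U x b a) U (X z) (P z) (Q z)) ∧
    (∀ {d : ℕ} {W : Set (Fin d → ℝ)}, IsSemialgebraic ℚ W → ∀ {n : ℕ} (V : Fin n → Fin (m + 2)) {Y : (Fin d → ℝ) → Fin n → ℝ} {P Q : (Fin d → ℝ) → ℝ}, (∀ i, IsSemialgebraicFunOn ℚ W fun z => Y z i) → IsSemialgebraicFunOn ℚ W P → IsSemialgebraicFunOn ℚ W Q → IsSemialgebraicFunOn ℚ W fun z => (fun V y a b => dHt V y b a) V (Y z) (P z) (Q z)) ∧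
    (∃ C : ℝ, ∀ (a : Fin (m + 2)) (ξ η : ℝ), 0 ≤ ξ → ξ ≤ (β : ℝ) → 0 ≤ η → η ≤ (α : ℝ) → (a ≠ ℓ' → |(fun a t s => gd a s t) a ξ η| ≤ C) ∧ (a ≠ ℓ → |(fun a t s => fd a s t) a ξ η| ≤ C) ∧ |(fun a t s => dd a s t) a ξ η| ≤ C ∧ (∀ η' : ℝ, 0 ≤ η' → η' ≤ (α : ℝ) → |(fun a t s => gd a s t) a ξ η - (fun a t s => gd a s t) a ξ η'| ≤ C * |η - η'|) ∧ (∀ ξ' : ℝ, 0 ≤ ξ' → ξ' ≤ (β : ℝ) → |(fun a t s => fd a s t) a ξ η - (fun a t s => fd a s t) a ξ' η| ≤ C * |ξ - ξ'|)) ∧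
    (∀ k : ℕ, ∃ C : ℝ, ∀ (U : Fin k → Fin (m + 2)) (x : Fin k → ℝ) (ξ η : ℝ), (∀ i, 0 ≤ x i ∧ x i ≤ 1) → 0 ≤ ξ → ξ ≤ (β : ℝ) → 0 ≤ η → η ≤ (α : ℝ) → |(fun U x a b => Vt U x b a) U x ξ η| ≤ C ∧ |(fun U x a b => dVt U x b a) U x ξ η| ≤ C ∧ (0 < k → |(fun U x a b => Vt U x b a) U x ξ η| ≤ C * ξ) ∧ (∀ η' : ℝ, 0 ≤ η' → η' ≤ (α : ℝ) → |(fun U x a b => Vt U x b a) U x ξ η - (fun U x a b => Vt U x b a) U x ξ η'| ≤ C * ξ * |η - η'|)) ∧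
    (∀ l : ℕ, ∃ C : ℝ, ∀ (V : Fin l → Fin (m + 2)) (y : Fin l → ℝ) (ξ η : ℝ), (∀ i, 0 ≤ y i ∧ y i ≤ 1) → 0 ≤ ξ → ξ ≤ (β : ℝ) → 0 ≤ η → η ≤ (α : ℝ) → |(fun V y a b => Ht V y b a) V y ξ η| ≤ C ∧ |(fun V y a b => dHt V y b a) V y ξ η| ≤ C ∧ (0 < l → |(fun V y a b => Ht V y b a) V y ξ η| ≤ C * η) ∧ (∀ ξ' : ℝ, 0 ≤ ξ' → ξ' ≤ (β : ℝ) → |(fun V y a b => Ht V y b a) V y ξ η - (fun V y a b => Ht V y b a) V y ξ' η| ≤ C * η * |ξ - ξ'|)) := by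
  obtain ⟨hwZ, hop, hopV, hAf, hBf, hdAf, hdBf, hF, hXb, hYb, hΘb, hHt_nil, hVt_nil, hdHt_nil, hdVt_nil, hHt_zero, hVt_zero, hfd_reg, hgd_reg, hdd_reg, hdd_reg', hpeel, hpeelV, hcentV, hcentH, hc01, hcflat, hcV0, hcH0, hfd_deriv, hgd_deriv, hHt_deriv, hVt_deriv, hHt_euler, hVt_euler, hHt_cont, hVt_cont, hsa_fd, hsa_gd, hsa_dd, hsa_Ht, hsa_Vt, hsa_dHt, hsa_dVt, hbd_letters, hbd_Ht, hbd_Vt⟩ := H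
  refine ⟨hwZ, hopV, hop, ?_, ?_, ?_, ?_, ?_, hXb, hYb, hΘb, ?_, ?_, ?_, ?_, ?_, ?_, ?_, ?_, ?_, ?_,
    ?_, ?_, ?_, ?_, ?_, ?_, ?_, ?_, ?_, ?_, ?_, ?_, ?_, ?_, ?_, ?_, ?_, ?_, ?_, ?_, ?_, ?_, ?_, ?_, ?_, ?_⟩
  -- hAf ↦ from hBf
  · intro μ k l x y ξ η
    show Bf μ y x η ξ = _
    rw [hBf, Finset.sum_comm]
  -- hBf ↦ from hAf
  · intro μ k l x y ξ η
    show Af μ y x η ξ = _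
    rw [hAf, Finset.sum_comm]
  -- hdAf ↦ from hdBf
  · intro μ k l x y ξ η
    show dBf μ y x η ξ = _
    rw [hdBf, Finset.sum_comm]
  -- hdBf ↦ from hdAf
  · intro μ k l x y ξ η
    show dAf μ y x η ξ = _
    rw [hdAf, Finset.sum_comm]
  -- hF
  · intro μ k l x y ξ η
    show -F μ y x η ξ = Bf μ y x η ξ - Af μ y x η ξ
    rw [hF]; ring
  -- edges
  · intro U x ξ η; exact hVt_nil U x η ξ
  · intro V y ξ η; exact hHt_nil V y η ξ
  · intro U x ξ η; exact hdVt_nil U x η ξ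
  · intro V y ξ η; exact hdHt_nil V y η ξ
  · intro k U x η; exact hVt_zero U x η
  · intro l V y ξ; exact hHt_zero V y ξ
  · intro t y; exact hgd_reg y t
  · intro x s; exact hfd_reg s x
  · intro x y; exact hdd_reg' y x
  · intro x y; exact hdd_reg y x
  -- peeling
  · intro μ k x₀ x' ξ η; exact hpeelV μ x₀ x' η ξ
  · intro μ l y₀ y' ξ η; exact hpeel μ y₀ y' η ξ
  -- centrality (series)
  · intro μ l P Q y η hy hη hηβ; exact hcentH μ P Q y η hy hη hηβ
  · intro μ k P Q x ξ hx hξ hξα; exact hcentV μ P Q x ξ hx hξ hξα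
  -- hc01
  · intro μ P Q
    have h := hc01 μ P Q
    have : P * (Zq ℓ' * Zq ℓ - Zq ℓ * Zq ℓ') * Q = -(P * (Zq ℓ * Zq ℓ' - Zq ℓ' * Zq ℓ) * Q) := by noncomm_ring
    rw [this, map_neg, h, neg_zero]
  -- hcflat
  · intro μ P Q x y hx hxβ hy hyα
    have h := hcflat μ P Q y x hy hyα hx hxβ
    rw [Finset.sum_comm] at h
    show ∑ a, ∑ b, gd a y x * fd b y x * (μ (P * (Zq a * Zq b - Zq b * Zq a) * Q) : ℝ) = 0
    have key : ∀ a b : Fin (m + 2), (μ (P * (Zq a * Zq b - Zq b * Zq a) * Q) : ℝ) =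
        -(μ (P * (Zq b * Zq a - Zq a * Zq b) * Q) : ℝ) := by
      intro a b
      have : P * (Zq a * Zq b - Zq b * Zq a) * Q = -(P * (Zq b * Zq a - Zq a * Zq b) * Q) := by noncomm_ring
      rw [this, map_neg, Rat.cast_neg]
    have e1 : (∑ a, ∑ b, gd a y x * fd b y x * (μ (P * (Zq a * Zq b - Zq b * Zq a) * Q) : ℝ)) =
        -(∑ a, ∑ b, fd b y x * gd a y x * (μ (P * (Zq b * Zq a - Zq a * Zq b) * Q) : ℝ)) := by
      rw [← Finset.sum_neg_distrib]
      refine Finset.sum_congr rfl fun a _ => ?_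
      rw [← Finset.sum_neg_distrib]
      refine Finset.sum_congr rfl fun b _ => ?_
      rw [key]; ring
    rw [e1, h, neg_zero]
  -- letter centralities
  · intro μ P Q s hs hsβ; exact hcH0 μ P Q s hs hsβ
  · intro μ P Q t ht htα; exact hcV0 μ P Q t ht htα
  -- calculus
  · intro a ξ η hξ hξβ hη hηα; exact hgd_deriv a η ξ hη hηα hξ hξβ
  · intro b ξ η hξ hξβ hη hηα; exact hfd_deriv b η ξ hη hηα hξ hξβ
  · intro k U x ξ η hx hξ hξβ hη hηα; exact hVt_deriv U x η ξ hx hη hηα hξ hξβ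
  · intro l V y ξ η hy hξ hξβ hη hηα; exact hHt_deriv V y η ξ hy hη hηα hξ hξβ
  · intro k U x₀ x' ξ η h0 h1 hx hξ hξβ hη hηα; exact hVt_euler U x₀ x' η ξ h0 h1 hx hη hηα hξ hξβ
  · intro l V y₀ y' ξ η h0 h1 hy hξ hξβ hη hηα; exact hHt_euler V y₀ y' η ξ h0 h1 hy hη hηα hξ hξβ
  · intro k U x' ξ η hx hξ hξβ hη hηα; exact hVt_cont U x' η ξ hx hη hηα hξ hξβ
  · intro l V y' ξ η hy hξ hξβ hη hηα; exact hHt_cont V y' η ξ hy hη hηα hξ hξβ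
  -- semialgebraicity
  · intro d W hW a T Y hT hY; exact hsa_gd hW a hY hT
  · intro d W hW b T Y hT hY; exact hsa_fd hW b hY hT
  · intro d W hW a T Y hT hY; exact hsa_dd hW a hY hT
  · intro d W hW n U X P Q hX hP hQ; exact hsa_Vt hW U hX hQ hP
  · intro d W hW n V Y P Q hY hP hQ; exact hsa_Ht hW V hY hQ hP
  · intro d W hW n U X P Q hX hP hQ; exact hsa_dVt hW U hX hQ hP
  · intro d W hW n V Y P Q hY hP hQ; exact hsa_dHt hW V hY hQ hP
  -- bounds
  · obtain ⟨C, hC⟩ := hbd_letters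
    refine ⟨C, fun a ξ η hξ hξβ hη hηα => ?_⟩
    obtain ⟨h1, h2, h3, h4, h5⟩ := hC a η ξ hη hηα hξ hξβ
    exact ⟨h2, h1, h3, fun η' hη' hη'α => h5 η' hη' hη'α, fun ξ' hξ' hξ'β => h4 ξ' hξ' hξ'β⟩
  · intro k
    obtain ⟨C, hC⟩ := hbd_Vt k
    exact ⟨C, fun U x ξ η hx hξ hξβ hη hηα => hC U x η ξ hx hη hηα hξ hξβ⟩
  · intro l
    obtain ⟨C, hC⟩ := hbd_Ht l
    exact ⟨C, fun V y ξ η hy hξ hξβ hη hηα => hC V y η ξ hy hη hηα hξ hξβ⟩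

end AbstractEngine

/-- **Hook `cornerEngineMirror_recast`** (registered form of `recast_rep_eq`): re-associating the
dimension of a representation along equal block sizes. [folklore] -/
theorem cornerEngineMirror_recast : ∀ (e k₁ k₂ l₁ l₂ : ℕ), k₁ = k₂ → l₁ = l₂ → ∀ (G : ∀ k l : ℕ, (Fin (k + l + e) → ℝ) → ℝ) (R : KZ.IntegralRep (k₁ + l₁ + e)), R.domain = KZ.cube (k₁ + l₁ + e) → R.integrand = G k₁ l₁ → ∃ R' : KZ.IntegralRep (k₂ + l₂ + e), R'.domain = KZ.cube (k₂ + l₂ + e) ∧ R'.integrand = G k₂ l₂ ∧ KZ.toPeriodAlgebra (KZ.toFormalPeriod (KZ.of R')) = KZ.toPeriodAlgebra (KZ.toFormalPeriod (KZ.of R)) :=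
  fun _ _ _ _ _ hk hl G R hRd hRi => recast_rep_eq hk hl G R hRd hRi

end Summit.KontsevichZagierPeriods.FurushoPentagon.PentagonInKZ
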